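import Mathlib.Combinatorics.SimpleGraph.Walk.Counting
import Mathlib.Combinatorics.SimpleGraph.Walk.Decomp
import Mathlib.Combinatorics.SimpleGraph.Finite
import Mathlib.Algebra.Order.BigOperators.Group.Finset
import Mathlib.Data.Finset.Powerset
import HarnessLib

/-!
# Counting connected sets (lattice animals) through a vertex: the `SimpleGraph` form

Trunk T-STATMECH (`Probability/LatticeModels`). Companion of
`Literature.Probability.LatticeModels.LatticeAnimals` (`card_connectedFamily_le`: the same
entropy bound in the "neighbour family / step relation" formalism, with the constant
`(Δ + 1)^{2n}` for the sets of cardinality `≤ n + 1`). This file states it for a locally finite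
`SimpleGraph` (so that Mathlib's `degree` / `neighborFinset` / `Walk` API applies — this is the
form consumed by the rooted plaquette graphs of the strong-coupling expansion on tori,
`LatticeGaugeHighTemperature`), with the sharper constant `Δ^{2(n-1)}` for the sets of
cardinality exactly `n` (the per-size count is what the weighted Kotecký–Preiss sums
`∑_k x^k #{S ∋ v : |S| = k}` need). The two connectedness predicates are related by
`isGraphConnected_iff_reflTransGen` (cut form ↔ reachability inside the set by the step
relation of `card_connectedFamily_le`). The Peierls/Kotecký–Preiss "entropy" bound:
in a graph all of whose degrees are at most `Δ`, the number of connected vertex sets of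
cardinality `n` containing a fixed vertex is at most `Δ^{2(n-1)}` (Friedli–Velenik, Lemma 3.38
with Exercise 5.3 / eq. (5.27): `#{S ∋ 0 : |S| = k} ≤ (2d)^{2k}` on `ℤ^d`). The proof is the one
of [FV17, Lemma 3.38]: a connected set `S ∋ v` carries a closed walk from `v` of length
`2(|S| - 1)` visiting exactly the vertices of `S` (build `S` up one adjacent vertex at a time
and insert a back-and-forth detour at each step), and there are at most `Δ^m` walks of length
`m` from `v`.

## Main statements (all proved)

* `IsGraphConnected G S`: the finite vertex set `S` cannot be split into two non-empty parts
  without an edge of `G` between them (for non-empty `S` this is connectedness of the induced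
  subgraph; it is the form in which connectedness is produced and consumed by polymer
  expansions). NB: in this cut form the empty set is connected (`isGraphConnected_empty`);
  consumers add `S.Nonempty` where needed. `isGraphConnected_iff_reflTransGen`: for `v ∈ S`,
  `IsGraphConnected G S ↔ ∀ w ∈ S, ReflTransGen (fun x y => G.Adj x y ∧ x ∈ S ∧ y ∈ S) v w`.
* `exists_walk_of_isGraphConnected`: the covering closed walk of length `2(|S| - 1)`.
* `card_finsetWalkLength_le_pow`: `#{walks of length m from u to v} ≤ Δ^m`.
* `card_le_pow_of_isGraphConnected`: a finite family of connected `n`-sets through `v` has at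
  most `Δ^{2(n-1)}` members (vertex form, sharper than the printed `(2d)^{2k}` of (5.27) and
  than the edge-crossing form of Lemma 3.38 as printed).

## References

* [FV17] S. Friedli, Y. Velenik, *Statistical Mechanics of Lattice Systems* (CUP 2017),
  Lemma 3.38 (p. 130) and Exercise 5.3, eq. (5.27) (p. 249).
-/

namespace Literature.Probability.LatticeModels

open Finset SimpleGraph

variable {V : Type*} [DecidableEq V] (G : SimpleGraph V)

/-- A finite vertex set `S` is `G`-connected if every non-empty proper part `A ⊊ S` is joined
to `S ∖ A` by an edge of `G` (equivalently, for non-empty `S`, the induced subgraph on `S` is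
connected). (Friedli–Velenik §3.7.2 / Lemma 3.38, "connected".) [cite: FriedliVelenik2017, Lemma 3.38] -/
def IsGraphConnected (S : Finset V) : Prop :=
  ∀ A ⊆ S, A.Nonempty → (S \ A).Nonempty → ∃ a ∈ A, ∃ b ∈ S \ A, G.Adj a b

/-- `IsGraphConnected` with the part ranging over the powerset (for decidability). [folklore] -/
theorem isGraphConnected_iff_forall_mem_powerset (S : Finset V) :
    IsGraphConnected G S ↔
      ∀ A ∈ S.powerset, A.Nonempty → (S \ A).Nonempty → ∃ a ∈ A, ∃ b ∈ S \ A, G.Adj a b := by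
  simp only [IsGraphConnected, Finset.mem_powerset]

/-- Connectedness of a finite set is decidable for a decidable adjacency relation. [folklore] -/
instance IsGraphConnected.instDecidablePred [DecidableRel G.Adj] :
    DecidablePred (IsGraphConnected G) := fun S =>
  decidable_of_iff _ (isGraphConnected_iff_forall_mem_powerset G S).symm

variable {G}

/-- Singletons are connected. [folklore] -/
theorem isGraphConnected_singleton (v : V) : IsGraphConnected G {v} := by
  intro A hA hAne hSA
  exfalso
  obtain ⟨a, ha⟩ := hAne
  obtain ⟨b, hb⟩ := hSA
  rw [Finset.mem_sdiff, Finset.mem_singleton] at hb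
  have := Finset.mem_singleton.1 (hA ha)
  subst this
  exact hb.2 (hb.1 ▸ ha)

/-- In the cut form the empty set is connected (vacuously). [folklore] -/
theorem isGraphConnected_empty : IsGraphConnected G (∅ : Finset V) :=
  fun _ hA hAne _ => absurd (Finset.subset_empty.1 hA) hAne.ne_empty

/-- **Cut connectedness is reachability inside the set**: for `v ∈ S`, `S` is `G`-connected iff
every `w ∈ S` is reachable from `v` by `G`-steps inside `S` (the connectedness predicate of
`LatticeAnimals.card_connectedFamily_le`, with `R = G.Adj`). [folklore] -/
theorem isGraphConnected_iff_reflTransGen {S : Finset V} {v : V} (hv : v ∈ S) :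
    IsGraphConnected G S ↔
      ∀ w ∈ S, Relation.ReflTransGen (fun x y => G.Adj x y ∧ x ∈ S ∧ y ∈ S) v w := by
  classical
  constructor
  · intro h w hw
    by_contra hnot
    set A := S.filter fun x => Relation.ReflTransGen (fun x y => G.Adj x y ∧ x ∈ S ∧ y ∈ S) v x
      with hA
    have hAS : A ⊆ S := Finset.filter_subset _ _
    have hAne : A.Nonempty := ⟨v, Finset.mem_filter.2 ⟨hv, Relation.ReflTransGen.refl⟩⟩
    have hcne : (S \ A).Nonempty := ⟨w, Finset.mem_sdiff.2 ⟨hw, fun h' => hnot (Finset.mem_filter.1 h').2⟩⟩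
    obtain ⟨a, ha, b, hb, hab⟩ := h A hAS hAne hcne
    obtain ⟨hbS, hbA⟩ := Finset.mem_sdiff.1 hb
    exact hbA (Finset.mem_filter.2 ⟨hbS, (Finset.mem_filter.1 ha).2.tail ⟨hab, hAS ha, hbS⟩⟩)
  · intro h A hAS hAne hcne
    obtain ⟨a₀, ha₀⟩ := hAne
    obtain ⟨b₀, hb₀⟩ := hcne
    haveI : Std.Symm (fun x y => G.Adj x y ∧ x ∈ S ∧ y ∈ S) := ⟨fun x y hxy => ⟨hxy.1.symm, hxy.2.2, hxy.2.1⟩⟩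
    have hpath : Relation.ReflTransGen (fun x y => G.Adj x y ∧ x ∈ S ∧ y ∈ S) a₀ b₀ :=
      (Std.Symm.symm _ _ (h a₀ (hAS ha₀))).trans (h b₀ (Finset.mem_sdiff.1 hb₀).1)
    -- along the path there is a first step leaving `A`
    have key : ∀ w, Relation.ReflTransGen (fun x y => G.Adj x y ∧ x ∈ S ∧ y ∈ S) a₀ w →
        w ∈ A ∨ ∃ a ∈ A, ∃ b ∈ S \ A, G.Adj a b := by
      intro w hw
      induction hw with
      | refl => exact Or.inl ha₀
      | @tail s t _ hst ih =>
        rcases ih with hs | hdone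
        · by_cases ht : t ∈ A
          · exact Or.inl ht
          · exact Or.inr ⟨s, hs, t, Finset.mem_sdiff.2 ⟨hst.2.2, ht⟩, hst.1⟩
        · exact Or.inr hdone
    rcases key b₀ hpath with hb | hdone
    · exact absurd hb (Finset.mem_sdiff.1 hb₀).2
    · exact hdone

/-- **Connectedness is transported by relabelings**: if `φ` is injective on `S` and respects
adjacency on `S`, then `S.image φ` is `G'`-connected iff `S` is `G`-connected. [folklore] -/
theorem isGraphConnected_image_iff {V' : Type*} [DecidableEq V'] {G' : SimpleGraph V'} {φ : V → V'}
    {S : Finset V} (hφ : Set.InjOn φ S) (hadj : ∀ a ∈ S, ∀ b ∈ S, (G'.Adj (φ a) (φ b) ↔ G.Adj a b)) :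
    IsGraphConnected G' (S.image φ) ↔ IsGraphConnected G S := by
  constructor
  · intro h A hA hAne hSA
    have hAimg : A.image φ ⊆ S.image φ := Finset.image_subset_image hA
    have hAne' : (A.image φ).Nonempty := hAne.image φ
    have hSA' : (S.image φ \ A.image φ).Nonempty := by
      obtain ⟨b, hb⟩ := hSA
      refine ⟨φ b, Finset.mem_sdiff.2 ⟨Finset.mem_image_of_mem φ (Finset.mem_sdiff.1 hb).1, fun h' => ?_⟩⟩
      obtain ⟨a, ha, hab⟩ := Finset.mem_image.1 h'
      exact (Finset.mem_sdiff.1 hb).2 (hφ (hA ha) (Finset.mem_sdiff.1 hb).1 hab ▸ ha)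
    obtain ⟨a', ha', b', hb', hab'⟩ := h (A.image φ) hAimg hAne' hSA'
    obtain ⟨a, ha, rfl⟩ := Finset.mem_image.1 ha'
    obtain ⟨hb'S, hb'A⟩ := Finset.mem_sdiff.1 hb'
    obtain ⟨b, hb, rfl⟩ := Finset.mem_image.1 hb'S
    refine ⟨a, ha, b, Finset.mem_sdiff.2 ⟨hb, fun hbA => hb'A (Finset.mem_image_of_mem φ hbA)⟩, ?_⟩
    exact (hadj a (hA ha) b hb).1 hab'
  · intro h A' hA' hA'ne hSA'
    -- pull back `A'` to `A = {a ∈ S | φ a ∈ A'}`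
    set A : Finset V := S.filter fun a => φ a ∈ A' with hAdef
    have hAS : A ⊆ S := Finset.filter_subset _ _
    have hAimg : A.image φ = A' := by
      ext x
      constructor
      · intro hx
        obtain ⟨a, ha, rfl⟩ := Finset.mem_image.1 hx
        exact (Finset.mem_filter.1 ha).2
      · intro hx
        obtain ⟨a, ha, rfl⟩ := Finset.mem_image.1 (hA' hx)
        exact Finset.mem_image.2 ⟨a, Finset.mem_filter.2 ⟨ha, hx⟩, rfl⟩
    have hAne : A.Nonempty := by
      obtain ⟨x, hx⟩ := hA'ne
      obtain ⟨a, ha, rfl⟩ := Finset.mem_image.1 (hA' hx)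
      exact ⟨a, Finset.mem_filter.2 ⟨ha, hx⟩⟩
    have hSA : (S \ A).Nonempty := by
      obtain ⟨x, hx⟩ := hSA'
      obtain ⟨hxS, hxA⟩ := Finset.mem_sdiff.1 hx
      obtain ⟨b, hb, rfl⟩ := Finset.mem_image.1 hxS
      exact ⟨b, Finset.mem_sdiff.2 ⟨hb, fun hbA => hxA (Finset.mem_filter.1 hbA).2⟩⟩
    obtain ⟨a, ha, b, hb, hab⟩ := h A hAS hAne hSA
    obtain ⟨hbS, hbA⟩ := Finset.mem_sdiff.1 hb
    refine ⟨φ a, hAimg ▸ Finset.mem_image_of_mem φ ha, φ b, Finset.mem_sdiff.2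
      ⟨Finset.mem_image_of_mem φ hbS, fun h' => hbA ?_⟩, (hadj a (hAS ha) b hbS).2 hab⟩
    rw [← hAimg] at h'
    obtain ⟨a₁, ha₁, h₁⟩ := Finset.mem_image.1 h'
    exact hφ (hAS ha₁) hbS h₁ ▸ ha₁

section Walks

/-- Inserting a back-and-forth detour `a → b → a` into a closed walk at a visited vertex `a`:
the length grows by `2` and the set of visited vertices by `b`. [folklore] -/
theorem exists_walk_insert_detour {v a b : V} (p : G.Walk v v) (ha : a ∈ p.support)
    (hab : G.Adj a b) :
    ∃ q : G.Walk v v, q.length = p.length + 2 ∧ q.support.toFinset = insert b p.support.toFinset := by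
  let q : G.Walk v v := (p.takeUntil a ha).append
    ((Walk.cons hab (Walk.cons hab.symm Walk.nil)).append (p.dropUntil a ha))
  have hsupp : p.support = (p.takeUntil a ha).support ++ (p.dropUntil a ha).support.tail := by
    conv_lhs => rw [← p.take_spec ha]
    exact Walk.support_append _ _
  have hlen : p.length = (p.takeUntil a ha).length + (p.dropUntil a ha).length := by
    conv_lhs => rw [← p.take_spec ha]
    exact Walk.length_append _ _
  refine ⟨q, ?_, ?_⟩
  · simp only [q, Walk.length_append, Walk.length_cons, Walk.length_nil]
    omega
  · have hq : q.support =
        (p.takeUntil a ha).support ++ (b :: a :: (p.dropUntil a ha).support.tail) := by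
      simp [q, Walk.support_append]
    have ha' : a ∈ (p.takeUntil a ha).support := Walk.end_mem_support _
    ext x
    rw [hq, hsupp]
    simp only [List.toFinset_append, List.toFinset_cons, List.mem_toFinset, Finset.mem_union,
      Finset.mem_insert]
    constructor
    · rintro (h | rfl | rfl | h)
      · exact Or.inr (Or.inl h)
      · exact Or.inl rfl
      · exact Or.inr (Or.inl ha')
      · exact Or.inr (Or.inr h)
    · rintro (rfl | h | h)
      · exact Or.inr (Or.inl rfl)
      · exact Or.inl h
      · exact Or.inr (Or.inr (Or.inr h))

/-- **Covering walk** (Friedli–Velenik Lemma 3.38, vertex form): a `G`-connected finite set `S`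
through `v` is the vertex set of a closed walk from `v` of length `2(|S| - 1)`. [cite: FriedliVelenik2017, Lemma 3.38] -/
theorem exists_walk_of_isGraphConnected {S : Finset V} (hS : IsGraphConnected G S) {v : V}
    (hv : v ∈ S) :
    ∃ p : G.Walk v v, p.length + 2 = 2 * S.card ∧ p.support.toFinset = S := by
  -- build up: for every `m ≤ |S|` a closed walk covering an `m`-subset of `S` through `v`
  have key : ∀ m : ℕ, 1 ≤ m → m ≤ S.card → ∃ A ⊆ S, v ∈ A ∧ A.card = m ∧
      ∃ p : G.Walk v v, p.length + 2 = 2 * m ∧ p.support.toFinset = A := by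
    intro m hm
    induction m, hm using Nat.le_induction with
    | base =>
      intro _
      refine ⟨{v}, Finset.singleton_subset_iff.2 hv, Finset.mem_singleton_self v,
        Finset.card_singleton v, Walk.nil, rfl, ?_⟩
      simp
    | succ m hm ih =>
      intro hmS
      obtain ⟨A, hAS, hvA, hAcard, p, hplen, hpsupp⟩ := ih (Nat.le_of_succ_le hmS)
      have hAne : A.Nonempty := ⟨v, hvA⟩
      have hSA : (S \ A).Nonempty := by
        rw [← Finset.card_pos, Finset.card_sdiff_of_subset hAS]
        omega
      obtain ⟨a, ha, b, hb, hab⟩ := hS A hAS hAne hSA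
      have hap : a ∈ p.support := by
        rw [← List.mem_toFinset, hpsupp]; exact ha
      obtain ⟨q, hqlen, hqsupp⟩ := exists_walk_insert_detour p hap hab
      have hbA : b ∉ A := (Finset.mem_sdiff.1 hb).2
      refine ⟨insert b A, Finset.insert_subset (Finset.mem_sdiff.1 hb).1 hAS,
        Finset.mem_insert_of_mem hvA, by rw [Finset.card_insert_of_notMem hbA, hAcard], q, ?_, ?_⟩
      · omega
      · rw [hqsupp, hpsupp]
  have hcard : 1 ≤ S.card := Finset.card_pos.2 ⟨v, hv⟩
  obtain ⟨A, hAS, -, hAcard, p, hplen, hpsupp⟩ := key S.card hcard le_rfl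
  have hA : A = S := Finset.eq_of_subset_of_card_le hAS (by rw [hAcard])
  exact ⟨p, hplen, hpsupp.trans hA⟩

variable [G.LocallyFinite]

/-- **Walk counting**: if all degrees are at most `Δ`, there are at most `Δ^m` walks of length
`m` between two given vertices. [folklore] -/
theorem card_finsetWalkLength_le_pow {Δ : ℕ} (hΔ : ∀ x, G.degree x ≤ Δ) (m : ℕ) (u v : V) :
    (G.finsetWalkLength m u v).card ≤ Δ ^ m := by
  induction m generalizing u with
  | zero =>
    unfold finsetWalkLength
    split_ifs with h
    · subst h; simp
    · simp
  | succ m ih =>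
    unfold finsetWalkLength
    refine (Finset.card_biUnion_le).trans ?_
    calc ∑ w : G.neighborSet u, ((G.finsetWalkLength m w v).map _).card
        ≤ ∑ _w : G.neighborSet u, Δ ^ m := Finset.sum_le_sum fun w _ => by
          rw [Finset.card_map]; exact ih w
      _ = G.degree u * Δ ^ m := by
          rw [Finset.sum_const, Finset.card_univ, smul_eq_mul, SimpleGraph.card_neighborSet_eq_degree]
      _ ≤ Δ ^ (m + 1) := by
          rw [pow_succ']; exact Nat.mul_le_mul_right _ (hΔ u)

/-- **Counting connected sets through a vertex** (Friedli–Velenik, Exercise 5.3 / (5.27) via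
Lemma 3.38): if all degrees of `G` are at most `Δ`, a finite family of `G`-connected sets of
cardinality `n` all containing the vertex `v` has at most `Δ^{2(n-1)}` members. [cite: FriedliVelenik2017, eq. (5.27) with Lemma 3.38] -/
theorem card_le_pow_of_isGraphConnected {Δ : ℕ} (hΔ : ∀ x, G.degree x ≤ Δ) {v : V} {n : ℕ}
    (𝒜 : Finset (Finset V))
    (h𝒜 : ∀ S ∈ 𝒜, v ∈ S ∧ S.card = n ∧ IsGraphConnected G S) :
    𝒜.card ≤ Δ ^ (2 * (n - 1)) := by
  classical
  -- choose a covering walk for each member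
  have hchoose : ∀ S ∈ 𝒜, ∃ p : G.Walk v v, p.length = 2 * (n - 1) ∧ p.support.toFinset = S := by
    intro S hS
    obtain ⟨hv, hcard, hconn⟩ := h𝒜 S hS
    obtain ⟨p, hplen, hpsupp⟩ := exists_walk_of_isGraphConnected hconn hv
    refine ⟨p, ?_, hpsupp⟩
    have : 1 ≤ n := by rw [← hcard]; exact Finset.card_pos.2 ⟨v, hv⟩
    omega
  choose! f hf using hchoose
  calc 𝒜.card ≤ (G.finsetWalkLength (2 * (n - 1)) v v).card := by
        refine Finset.card_le_card_of_injOn f (fun S hS => ?_) ?_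
        · rw [Finset.mem_coe, SimpleGraph.mem_finsetWalkLength_iff]
          exact (hf S hS).1
        · intro S₁ hS₁ S₂ hS₂ hS
          rw [← (hf S₁ hS₁).2, ← (hf S₂ hS₂).2, hS]
    _ ≤ Δ ^ (2 * (n - 1)) := card_finsetWalkLength_le_pow hΔ _ v v

end Walks

end Literature.Probability.LatticeModels
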